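import Mathlib.Algebra.QuadraticDiscriminant
import Summits.RiemannHypothesis.RiemannHypothesis.Theorems.NymanBeurlingTailLeaf
import Summits.RiemannHypothesis.RiemannHypothesis.Theorems.NymanBeurlingTailLeverage
import Summits.RiemannHypothesis.RiemannHypothesis.Theorems.NymanBeurlingMinimiser
import HarnessLib

/-!
# RiemannHypothesis / Nyman–Beurling — SHARP TAIL LEVERAGE (RH-FREE per N): `Q·tailConst(c)² ≤ ∫_0^1 f_c²`, `s_N ≤ 1/Q`

Column LI/NB of the RH ladder, rung L-P(P2) «structure of the NB minimiser», PROOF-OF-DATA for cell `pub/rh-li`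
(theory memo `theory/TARGETS.md` §8.2 (T1)/(T2); this file sharpens the landed `nbTailLeverageBound` /
`nbTailConstLeDist` of `NymanBeurlingTailLeverage.lean`).

THE POINT.  The fluctuation `q = {1/x}·1_{(0,1]} − h` (`nbFluct`; `h = E[{1/x} | I_n]`, `Q = ‖q‖²_{(0,1]} = nbQ`)
REPRESENTS THE TAIL FUNCTIONAL on Nyman's interval: by the landed key orthogonality `⟨ρ_{k+1}, q⟩_{(0,1]} = Q/(k+1)`
(`nbKeyOrthogonality_holds`), for every coefficient vector `c`
  `⟨f_c, q⟩_{(0,1]} = Q · tailConst(c)`,  `f_c = Σ_k c_k ρ_{k+1}`   (`integral_sum_mul_nbFluct`),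
and `∫_{(0,1]} q = 0` (`integral_nbFluct`), so `⟨χ − f_c, q⟩_{(0,1]} = −Q·tailConst(c)` (`integral_approx_mul_nbFluct`).
Cauchy–Schwarz against `q` then gives, for EVERY `N` and EVERY `c : Fin N → ℝ`:
* `nbTailLeverageBound_sharp`:  `Q · tailConst(c)² ≤ ∫_{(0,1]} f_c²`  (landed constant: `1 − 2 log²2 = 0.0391`);
* `nbTailConstLeDist_sharp`:   `(1 + Q) · tailConst(c)² ≤ d_N²(c)`  (landed constant: `2 − 2 log²2 = 1.039`);
* `nbLeverage_le_inv_nbQ`:      the head/tail LEVERAGE `s_N = wᵀ(G⁰)⁻¹w = Σ_k u_k/(k+1)` (`G⁰u = w`, `w_k = 1/(k+1)`,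
  the quantity of the Sherman–Morrison identity `nbHeadTailIdentity`: `tailConst(c⋆_N) = τ⁰_N/(1+s_N)`,
  `d_N² = d⁰_N² + τ⁰_N²/(1+s_N)`) satisfies `s_N ≤ 1/Q` for every `N` (theory's kernel bound was `1/(1 − 2log²2) = 25.6`);
* `one_sub_two_mul_log_two_sq_le_nbQ`, `nbQ_pos`:  `1 − 2 log²2 ≤ Q`, `0 < Q` (the fluctuation on the top cell
  `(1/2, 1]` is `1/x − 2 log 2`, whose square integrates to `1 − 2 log²2`) — so the sharp bounds contain the landed ones.

DATA COMPARISON (not used, not claimed in the kernel): float `Q = 0.0803270395…`, `1/Q = 12.449`; the certified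
lineage-R / float lineage-C2 leverage is `s_N = 3.84, 6.92, 11.40, 12.10, 12.24, 12.31, 12.32` at
`N = 1, 2, 5, 20, 100, 1000, 2000` (theory/NBHeadTail.lean, kit j243603; DATA.md §L) — the measured plateau sits 1 % under the
new kernel ceiling.  `s_N → 1/Q` would say that `q` lies in the closed span of the dilates on `(0,1]`; that is implied by RH
(Báez-Duarte: `χ`, hence every `χ(n·)`, hence `h`, is in the closed span) and is NOT claimed here.

RH-FREE [rh-li-eng-3 g5]: finite-`N` real analysis (Cauchy–Schwarz in `L²(0,1]`); no statement about `d_N → 0` is made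
or used; the criterion `RH ⇔ d_N → 0` (`baezDuarte_iff_holds`) is RH-EQUIVALENT and untouched.  Nothing here bears on the
truth of RH.
-/

noncomputable section

-- D-0017: `Summit.<S>.<S>.…` is the designed namespace of a single-problem summit.
set_option linter.dupNamespace false

open MeasureTheory Set Finset
open scoped Matrix

namespace Summit.RiemannHypothesis.RiemannHypothesis.Theorems.NbTheory

open Literature.NumberTheory.LFunctions Literature.NumberTheory.LFunctions.BaezDuarteOnlyIf GramPosDef Minimiser

namespace TailLeverageSharp

/-- `q²` is integrable on `(0,1]`. -/
lemma integrableOn_nbFluct_sq : IntegrableOn (fun x : ℝ ↦ nbFluct x ^ 2) (Set.Ioc (0 : ℝ) 1) := by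
  refine integrableOn_Ioc_of_bounded (measurable_nbFluct.pow_const 2) (M := 4) fun x ↦ ?_
  rw [abs_pow]
  have := abs_nbFluct_le x
  nlinarith [abs_nonneg (nbFluct x)]

/-- **Cauchy–Schwarz against the fluctuation.**  For `g` with `g²` and `g·q` integrable on `(0,1]`:
`(∫_{(0,1]} g q)² ≤ (∫_{(0,1]} g²) · Q` (discriminant of `t ↦ ∫ (t g − q)² ≥ 0`). -/
theorem sq_integral_mul_nbFluct_le (g : ℝ → ℝ)
    (hg2 : IntegrableOn (fun x ↦ g x ^ 2) (Set.Ioc (0 : ℝ) 1))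
    (hgq : IntegrableOn (fun x ↦ g x * nbFluct x) (Set.Ioc (0 : ℝ) 1)) :
    (∫ x in Set.Ioc (0 : ℝ) 1, g x * nbFluct x) ^ 2 ≤ (∫ x in Set.Ioc (0 : ℝ) 1, g x ^ 2) * nbQ := by
  set A : ℝ := ∫ x in Set.Ioc (0 : ℝ) 1, g x ^ 2 with hA
  set B : ℝ := ∫ x in Set.Ioc (0 : ℝ) 1, g x * nbFluct x with hB
  -- `∫ (t g − q)² = t² A − 2 t B + Q ≥ 0` for every real `t`
  have hquad : ∀ t : ℝ, 0 ≤ A * (t * t) + (-2 * B) * t + nbQ := by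
    intro t
    have hexp : ∫ x in Set.Ioc (0 : ℝ) 1, (t * g x - nbFluct x) ^ 2 = A * (t * t) + (-2 * B) * t + nbQ := by
      have h1 : IntegrableOn (fun x ↦ t ^ 2 * g x ^ 2) (Set.Ioc (0 : ℝ) 1) := hg2.const_mul _
      have h2 : IntegrableOn (fun x ↦ 2 * t * (g x * nbFluct x)) (Set.Ioc (0 : ℝ) 1) := hgq.const_mul _
      have h12 : IntegrableOn (fun x ↦ t ^ 2 * g x ^ 2 - 2 * t * (g x * nbFluct x)) (Set.Ioc (0 : ℝ) 1) :=
        h1.sub h2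
      have hcongr : ∫ x in Set.Ioc (0 : ℝ) 1, (t * g x - nbFluct x) ^ 2 =
          ∫ x in Set.Ioc (0 : ℝ) 1, (t ^ 2 * g x ^ 2 - 2 * t * (g x * nbFluct x) + nbFluct x ^ 2) :=
        setIntegral_congr_fun measurableSet_Ioc fun x _ ↦ by ring
      rw [hcongr, integral_add h12 integrableOn_nbFluct_sq, integral_sub h1 h2, integral_const_mul,
        integral_const_mul, hA, hB, nbQ]
      ring
    rw [← hexp]
    exact setIntegral_nonneg measurableSet_Ioc fun x _ ↦ sq_nonneg _
  have hdisc := discrim_le_zero hquad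
  rw [discrim] at hdisc
  nlinarith [hdisc]

/-- `⟨f_c, q⟩_{(0,1]} = Q · tailConst(c)`: the fluctuation represents the tail functional (key orthogonality, summed). -/
theorem integral_sum_mul_nbFluct {N : ℕ} (c : Fin N → ℝ) :
    ∫ x in Set.Ioc (0 : ℝ) 1, (∑ k : Fin N, c k * nbRho k x) * nbFluct x = nbQ * tailConst c := by
  have hint : ∀ k : Fin N, IntegrableOn (fun x ↦ c k * (nbRho k x * nbFluct x)) (Set.Ioc (0 : ℝ) 1) :=
    fun k ↦ (integrableOn_nbRho_mul_nbFluct k).const_mul _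
  calc ∫ x in Set.Ioc (0 : ℝ) 1, (∑ k : Fin N, c k * nbRho k x) * nbFluct x
      = ∫ x in Set.Ioc (0 : ℝ) 1, ∑ k : Fin N, c k * (nbRho k x * nbFluct x) := by
        refine setIntegral_congr_fun measurableSet_Ioc fun x _ ↦ ?_
        rw [Finset.sum_mul]
        exact Finset.sum_congr rfl fun k _ ↦ by ring
    _ = ∑ k : Fin N, c k * (nbQ / ((k : ℕ) + 1 : ℝ)) := by
        rw [integral_finsetSum _ fun k _ ↦ hint k]
        refine Finset.sum_congr rfl fun k _ ↦ ?_
        rw [integral_const_mul, nbKeyOrthogonality_holds k]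
    _ = nbQ * tailConst c := by
        rw [tailConst, Finset.mul_sum]
        exact Finset.sum_congr rfl fun k _ ↦ by ring

/-- `∫_{(0,1]} q = 0` (the fluctuation has mean zero on every Farey cell). -/
theorem integral_nbFluct : ∫ x in Set.Ioc (0 : ℝ) 1, nbFluct x = 0 := by
  have h := nbFluctStepOrthogonal_holds (fun _ ↦ (1 : ℝ)) ⟨1, fun _ ↦ by simp⟩
  simpa using h

/-- `f_c²` is integrable on `(0,1]` (bounded measurable). -/
lemma integrableOn_sum_mul_nbRho_sq {N : ℕ} (c : Fin N → ℝ) :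
    IntegrableOn (fun x ↦ (∑ k : Fin N, c k * nbRho k x) ^ 2) (Set.Ioc (0 : ℝ) 1) := by
  refine integrableOn_Ioc_of_bounded ((measurable_sum_mul_nbRho c).pow_const 2) (M := (∑ k : Fin N, |c k|) ^ 2)
    fun x ↦ ?_
  rw [abs_pow]
  exact pow_le_pow_left₀ (abs_nonneg _) (abs_sum_mul_nbRho_le c x) 2

/-- `f_c·q` is integrable on `(0,1]`. -/
lemma integrableOn_sum_mul_nbRho_mul_nbFluct {N : ℕ} (c : Fin N → ℝ) :
    IntegrableOn (fun x ↦ (∑ k : Fin N, c k * nbRho k x) * nbFluct x) (Set.Ioc (0 : ℝ) 1) := by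
  have hint : ∀ k : Fin N, IntegrableOn (fun x ↦ c k * (nbRho k x * nbFluct x)) (Set.Ioc (0 : ℝ) 1) :=
    fun k ↦ (integrableOn_nbRho_mul_nbFluct k).const_mul _
  have hsum : IntegrableOn (fun x ↦ ∑ k : Fin N, c k * (nbRho k x * nbFluct x)) (Set.Ioc (0 : ℝ) 1) :=
    integrable_finsetSum _ fun k _ ↦ hint k
  refine hsum.congr_fun (fun x _ ↦ ?_) measurableSet_Ioc
  simp only [Finset.sum_mul]
  exact Finset.sum_congr rfl fun k _ ↦ by ring

/-- `⟨χ − f_c, q⟩_{(0,1]} = −Q · tailConst(c)`. -/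
theorem integral_approx_mul_nbFluct {N : ℕ} (c : Fin N → ℝ) :
    ∫ x in Set.Ioc (0 : ℝ) 1, approx c x * nbFluct x = -(nbQ * tailConst c) := by
  have hcongr : ∫ x in Set.Ioc (0 : ℝ) 1, approx c x * nbFluct x =
      ∫ x in Set.Ioc (0 : ℝ) 1, (nbFluct x - (∑ k : Fin N, c k * nbRho k x) * nbFluct x) :=
    setIntegral_congr_fun measurableSet_Ioc fun x hx ↦ by rw [approx_eq_of_mem_Ioc c hx]; ring
  rw [hcongr, integral_sub integrableOn_nbFluct (integrableOn_sum_mul_nbRho_mul_nbFluct c), integral_nbFluct,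
    integral_sum_mul_nbFluct, zero_sub]

/-- `(χ − f_c)·q` is integrable on `(0,1]`. -/
lemma integrableOn_approx_mul_nbFluct {N : ℕ} (c : Fin N → ℝ) :
    IntegrableOn (fun x ↦ approx c x * nbFluct x) (Set.Ioc (0 : ℝ) 1) := by
  have hsub : IntegrableOn (fun x ↦ nbFluct x - (∑ k : Fin N, c k * nbRho k x) * nbFluct x) (Set.Ioc (0 : ℝ) 1) :=
    integrableOn_nbFluct.sub (integrableOn_sum_mul_nbRho_mul_nbFluct c)
  refine hsub.congr_fun (fun x hx ↦ ?_) measurableSet_Ioc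
  simp only [approx_eq_of_mem_Ioc c hx]
  ring

/-- On the top Farey cell `(1/2, 1]` the fluctuation is `q(x) = 1/x − 2 log 2` (`{1/x} = 1/x − 1`, `h = m_1 = 2 log 2 − 1`). -/
lemma nbFluct_eq_of_mem {x : ℝ} (hx : x ∈ Set.Ioc (1 / 2 : ℝ) 1) : nbFluct x = 1 / x - 2 * Real.log 2 := by
  have hx0 : 0 < x := by linarith [hx.1]
  have hxI : x ∈ nbI 0 := by
    rw [nbI]; constructor <;> norm_num <;> linarith [hx.1, hx.2]
  have hfl : ⌊1 / x⌋₊ = 1 := by simpa using floor_eq_of_mem_nbI hxI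
  have hfract : Int.fract (1 / x) = 1 / x - 1 := by
    have := TailLeverage.nbRho_zero_eq hx
    simpa [nbRho] using this
  have hm1 : nbFareyMean 1 = 2 * Real.log 2 - 1 := by
    simp [nbFareyMean]; norm_num
  simp only [nbFluct, nbStepH, hx0, hx.2, and_self, if_true, hfl, hfract, hm1]
  ring

end TailLeverageSharp

open TailLeverageSharp

/-! ## `Q` is bounded below by the top cell: `1 − 2 log²2 ≤ Q`, so `0 < Q` -/

/-- **`1 − 2 log²2 ≤ Q`** (the landed leverage constant is the top-cell share of `Q`):
`Q = ∫_{(0,1]} q² ≥ ∫_{(1/2,1]} (1/x − 2 log 2)² = 1 − 2 log²2`. -/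
theorem one_sub_two_mul_log_two_sq_le_nbQ : 1 - 2 * Real.log 2 ^ 2 ≤ nbQ := by
  have hsub : Set.Ioc (1 / 2 : ℝ) 1 ⊆ Set.Ioc 0 1 := Set.Ioc_subset_Ioc (by norm_num) le_rfl
  have hmono : ∫ x in Set.Ioc (1 / 2 : ℝ) 1, nbFluct x ^ 2 ≤ ∫ x in Set.Ioc (0 : ℝ) 1, nbFluct x ^ 2 :=
    setIntegral_mono_set integrableOn_nbFluct_sq (ae_of_all _ fun x ↦ sq_nonneg _) (ae_of_all _ hsub)
  have hval : ∫ x in Set.Ioc (1 / 2 : ℝ) 1, nbFluct x ^ 2 = 1 - 2 * Real.log 2 ^ 2 := by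
    rw [setIntegral_congr_fun measurableSet_Ioc fun x hx ↦ by rw [nbFluct_eq_of_mem hx],
      ← intervalIntegral.integral_of_le (by norm_num : (1 / 2 : ℝ) ≤ 1), TailLeverage.integral_sq_eq 1 (2 * Real.log 2)]
    ring
  rw [nbQ, ← hval]
  exact hmono

/-- **`0 < Q`.** -/
theorem nbQ_pos : 0 < nbQ := lt_of_lt_of_le one_sub_two_mul_log_two_sq_pos one_sub_two_mul_log_two_sq_le_nbQ

/-! ## The sharp leverage bounds -/

/-- **SHARP TAIL LEVERAGE (RH-FREE per N).**  For every coefficient vector `c : Fin N → ℝ`: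
`Q · tailConst(c)² ≤ ∫_{(0,1]} (Σ_k c_k ρ_{k+1})²` — Cauchy–Schwarz against `q`, which represents the tail functional
(`⟨f_c, q⟩ = Q·tailConst(c)`).  Sharpens `nbTailLeverageBound` (`1 − 2log²2 ≤ Q`). -/
theorem nbTailLeverageBound_sharp (N : ℕ) (c : Fin N → ℝ) :
    nbQ * tailConst c ^ 2 ≤ ∫ x in Set.Ioc (0 : ℝ) 1, (∑ k : Fin N, c k * nbRho k x) ^ 2 := by
  have hcs := sq_integral_mul_nbFluct_le (fun x ↦ ∑ k : Fin N, c k * nbRho k x)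
    (integrableOn_sum_mul_nbRho_sq c) (integrableOn_sum_mul_nbRho_mul_nbFluct c)
  rw [integral_sum_mul_nbFluct c] at hcs
  -- `Q² τ² ≤ A·Q` with `Q > 0`
  have hQ := nbQ_pos
  nlinarith [hcs, hQ, sq_nonneg (tailConst c)]

/-- **SHARP HEAD DISTANCE BOUND (RH-FREE per N).**  `Q · tailConst(c)² ≤ ∫_{(0,1]} (χ − f_c)²`
(`⟨χ − f_c, q⟩ = −Q·tailConst(c)` since `∫ q = 0`). -/
theorem nbQ_mul_tailConst_sq_le_integral_sq_approx (N : ℕ) (c : Fin N → ℝ) :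
    nbQ * tailConst c ^ 2 ≤ ∫ x in Set.Ioc (0 : ℝ) 1, approx c x ^ 2 := by
  have hcs := sq_integral_mul_nbFluct_le (approx c)
    ((integrableOn_sq_approx c).mono_set Set.Ioc_subset_Ioi_self) (integrableOn_approx_mul_nbFluct c)
  rw [integral_approx_mul_nbFluct c, neg_sq] at hcs
  have hQ := nbQ_pos
  nlinarith [hcs, hQ, sq_nonneg (tailConst c)]

/-- **SHARP DISTANCE FORM (RH-FREE per N).**  For every coefficient vector: `(1 + Q) · tailConst(c)² ≤ d_N²(c)`
(head `≥ Q·τ²` by Cauchy–Schwarz against `q`, tail `= τ²` exactly).  Sharpens `nbTailConstLeDist` (`2 − 2log²2`). -/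
theorem nbTailConstLeDist_sharp (N : ℕ) (c : Fin N → ℝ) :
    (1 + nbQ) * tailConst c ^ 2 ≤ nbDistSq N c := by
  have hint := integrableOn_sq_approx c
  have hsplit : ∫ x in Set.Ioi (0 : ℝ), approx c x ^ 2 =
      (∫ x in Set.Ioc (0 : ℝ) 1, approx c x ^ 2) + ∫ x in Set.Ioi (1 : ℝ), approx c x ^ 2 := by
    rw [← Set.Ioc_union_Ioi_eq_Ioi zero_le_one,
      setIntegral_union Set.Ioc_disjoint_Ioi_same measurableSet_Ioi
        (hint.mono_set Set.Ioc_subset_Ioi_self) (hint.mono_set (Set.Ioi_subset_Ioi zero_le_one))]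
  have hhead := nbQ_mul_tailConst_sq_le_integral_sq_approx N c
  rw [nbDistSq_eq_integral, hsplit, integral_Ioi_one_sq_approx]
  linarith

/-- **THE LEVERAGE IS AT MOST `1/Q` (RH-FREE per N).**  If `G⁰ u = w` (`w_k = 1/(k+1)`; `G⁰` = Gram matrix of the dilates on
Nyman's interval), then the leverage `s_N = Σ_k u_k/(k+1) = wᵀ(G⁰)⁻¹w` of the Sherman–Morrison identity `nbHeadTailIdentity`
satisfies `Q · s_N ≤ 1`: indeed `s_N = uᵀG⁰u = ∫_{(0,1]} f_u² ≥ Q·tailConst(u)² = Q·s_N²`. -/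
theorem nbQ_mul_leverage_le_one (N : ℕ) (u : Fin N → ℝ)
    (hu : ∀ k : Fin N, ∑ j : Fin N, nbGram0 k j * u j = 1 / ((k : ℝ) + 1)) :
    nbQ * ∑ k : Fin N, u k / ((k : ℝ) + 1) ≤ 1 := by
  set s : ℝ := ∑ k : Fin N, u k / ((k : ℝ) + 1) with hs
  have hτ : tailConst u = s := by rw [hs, tailConst]
  -- `uᵀ G⁰ u = s`
  have hform : u ⬝ᵥ (nbGram0Matrix N *ᵥ u) = s := by
    have hmv : ∀ k, (nbGram0Matrix N *ᵥ u) k = ∑ j : Fin N, nbGram0 k j * u j := by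
      intro k; simp [Matrix.mulVec, dotProduct, nbGram0Matrix]
    rw [dotProduct, hs]
    refine Finset.sum_congr rfl fun k _ ↦ ?_
    rw [hmv, hu k]
    ring
  -- `Q s² ≤ uᵀ G⁰ u = s`
  have hle : nbQ * s ^ 2 ≤ s := by
    have h := nbTailLeverageBound_sharp N u
    rw [hτ, ← dotProduct_nbGram0Matrix_mulVec, hform] at h
    exact h
  have hQ := nbQ_pos
  by_cases hs0 : 0 < s
  · nlinarith
  · push Not at hs0
    nlinarith

/-- **`s_N ≤ 1/Q`** (same statement, divided through; float `1/Q = 12.449`, certified data plateau `s_2000 = 12.32`;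
the landed kernel bound was `1/(1 − 2 log²2) = 25.6`). -/
theorem nbLeverage_le_inv_nbQ (N : ℕ) (u : Fin N → ℝ)
    (hu : ∀ k : Fin N, ∑ j : Fin N, nbGram0 k j * u j = 1 / ((k : ℝ) + 1)) :
    ∑ k : Fin N, u k / ((k : ℝ) + 1) ≤ 1 / nbQ := by
  rw [le_div_iff₀ nbQ_pos, mul_comm]
  exact nbQ_mul_leverage_le_one N u hu

/-- **Sharp tail leverage for the DATA object:** `(1 + Q)·tailConst(c⋆_N)² ≤ d_N²` for the Báez-Duarte minimiser
`c⋆_N = G⁻¹b`, i.e. `κ_N²·d_N² ≤ 1/(1+Q)` (sharpens `tailConst_nbMinimiser_sq_le`). -/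
theorem tailConst_nbMinimiser_sq_le_sharp (N : ℕ) :
    (1 + nbQ) * tailConst (nbMinimiser N) ^ 2 ≤ nbDistSq N (nbMinimiser N) :=
  nbTailConstLeDist_sharp N (nbMinimiser N)

/-- The sharp bound contains the landed one: `1/Q ≤ 1/(1 − 2 log²2)`. -/
theorem inv_nbQ_le : 1 / nbQ ≤ 1 / (1 - 2 * Real.log 2 ^ 2) :=
  one_div_le_one_div_of_le one_sub_two_mul_log_two_sq_pos one_sub_two_mul_log_two_sq_le_nbQ

end Summit.RiemannHypothesis.RiemannHypothesis.Theorems.NbTheory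

end
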